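import Literature.AlgebraicTopology.SingularHomology.IntegralLattice
import Literature.AlgebraicTopology.SingularHomology.CohomologyRingChange
import HarnessLib

/-!
# Integral classes detected by integral cycles survive the change of coefficients `ℤ → K`

A. Hatcher, *Algebraic Topology* (2002), §3.1 p. 198 (change of coefficients) with Thm. 3.2: for a
field `K` of characteristic zero and an integral cohomology class `β ∈ Hᵏ(T; ℤ)` whose Kronecker
pairing with some integral homology class `z` is non-zero, the image of `β` in `Hᵏ(T; K)` is
non-zero — it pairs to the same non-zero number with `z ⊗ 1`. In the tree's language
(`singularCohomology.ringChange`, `…CohomologyRingChange`; `baseChangeChain`, `evalChain`,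
`…IntegralLattice`):

* `singularCohomology.ringChange_map` — `ringChange` is natural in continuous maps;
* `kroneckerPairing_ringChange_eq_cast` — `⟨β ⊗ 1, z ⊗ 1⟩ = ⟨β, z⟩` in `K`;
* **`ringChange_ne_zero_of_kroneckerPairing_ne_zero`** — `⟨β, z⟩ ≠ 0 ⇒ β ⊗ 1 ≠ 0`.

Everything is proved; no named facts. Consumer: the HL-free upper range of Lefschetz's theorem for
hypersurfaces (`Literature/AlgebraicGeometry/HodgeTheory`), passing the integral degree computation
`⟨ι^*α, [Z]⟩ ≠ 0` to complex coefficients.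

## References

* A. Hatcher, *Algebraic Topology*, CUP 2002, §3.1 p. 198 and Thm. 3.2. [HatcherAT2002]
-/

noncomputable section

open CategoryTheory

namespace Literature.AlgebraicTopology.SingularHomology

open singularChainComplex singularCochainComplex

-- `ℤ`, the spaces and the field live in `Type` (the universe constraints of `ringChange` and
-- `baseChangeChain`); the consumer has `T = Z(ℂ) : Type`, `K = ℂ`.
variable {R S : Type} [CommRing R] [CommRing S] (f : R →+* S)
variable {T T' : Type} [TopologicalSpace T] [TopologicalSpace T'] {k : ℕ}

/-- **Change of ring is natural in continuous maps**: `(φ^* β) ⊗ 1 = φ^* (β ⊗ 1)` (both act on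
cochains, one by pre-, the other by post-composition). [cite: HatcherAT2002, §3.1 p. 198] -/
theorem singularCohomology.ringChange_map (φ : C(T, T')) (β : singularCohomology R R T' k) :
    singularCohomology.ringChange f T k (singularCohomology.map R R φ k β) =
      singularCohomology.map S S φ k (singularCohomology.ringChange f T' k β) := by
  induction β using singularCohomology_induction_on with
  | h u =>
    rw [singularCohomology.map_π, singularCohomology.ringChange_π, singularCohomology.ringChange_π,
      singularCohomology.map_π]
    congr 1
    refine coFn_injective ?_
    rw [coFn_cocyclesRingChange]
    funext σ
    change f (iCocycles R R T k (cocyclesMap R R φ k u) σ) =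
      iCocycles S S T k (cocyclesMap S S φ k (cocyclesRingChange f k u)) σ
    rw [iCocycles_cocyclesMap, iCocycles_cocyclesMap, map_apply, map_apply]
    change f (coFn u (σ.map φ)) = coFn (cocyclesRingChange f k u) (σ.map φ)
    rw [coFn_cocyclesRingChange, Function.comp_apply]

variable (K : Type) [Field K] [Algebra ℤ K]

/-- An integral cycle gives a `K`-cycle `z ⊗ 1` (`baseChangeChain` commutes with the boundary).
[cite: HatcherAT2002, §2.2] -/
theorem exists_cycles_baseChangeChain (z : cycles ℤ ℤ T k) :
    ∃ z' : cycles K K T k, iCycles K K T k z' = baseChangeChain ℤ K k (iCycles ℤ ℤ T k z) := by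
  have hd : (singularChainComplex K K T).d k ((ComplexShape.down ℕ).next k)
      (baseChangeChain ℤ K k (iCycles ℤ ℤ T k z)) = 0 := by
    cases k with
    | zero =>
      rw [(singularChainComplex K K T).shape 0 _ (by simp)]
      rfl
    | succ k =>
      rw [ChainComplex.next_nat_succ, d_baseChangeChain]
      have : (singularChainComplex ℤ ℤ T).d (k + 1) k (iCycles ℤ ℤ T (k + 1) z) = 0 := by
        have h := (singularChainComplex ℤ ℤ T).iCycles_d (k + 1) k
        exact congrFun (congrArg (fun g => (ConcreteCategory.hom g : _ → _)) h) z
      rw [this, map_zero]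
  exact exists_cycles_of_d_eq_zero rfl _ hd

/-- **`⟨β ⊗ 1, z ⊗ 1⟩ = ⟨β, z⟩`**: the Kronecker pairing of the ring-changed class with the
base-changed cycle is the image of the integral pairing (Hatcher 2002, §3.1 p. 198).
[cite: HatcherAT2002, §3.1 p. 198] -/
theorem kroneckerPairing_ringChange_eq_cast (a : cocycles ℤ ℤ T k) (z : cycles ℤ ℤ T k)
    (z' : cycles K K T k) (hz' : iCycles K K T k z' = baseChangeChain ℤ K k (iCycles ℤ ℤ T k z)) :
    kroneckerPairing K K T k (singularCohomology.ringChange (algebraMap ℤ K) T k (singularCohomology.π ℤ ℤ T k a))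
        ((singularChainComplex K K T).homologyπ k z') =
      algebraMap ℤ K (kroneckerPairing ℤ ℤ T k (singularCohomology.π ℤ ℤ T k a)
        ((singularChainComplex ℤ ℤ T).homologyπ k z)) := by
  rw [singularCohomology.ringChange_π, kroneckerPairing_π_homologyπ_eq_evalChain, hz',
    kroneckerPairing_π_homologyπ_eq_evalChain]
  change evalChain (coFn (cocyclesRingChange (algebraMap ℤ K) k a)) _ = _
  rw [coFn_cocyclesRingChange]
  exact evalChain_baseChange ℤ K (coFn a) (iCycles ℤ ℤ T k z)

/-- **An integral class pairing non-trivially with an integral cycle is non-zero over `K`**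
(`K` a field of characteristic zero): if `⟨β, z⟩ ≠ 0` for `β ∈ Hᵏ(T; ℤ)`, `z ∈ Hₖ(T; ℤ)`, then
`β ⊗ 1 ≠ 0` in `Hᵏ(T; K)`. [cite: HatcherAT2002, §3.1 p. 198 and Thm. 3.2] -/
theorem ringChange_ne_zero_of_kroneckerPairing_ne_zero [CharZero K] (β : singularCohomology ℤ ℤ T k)
    (z : singularHomology ℤ ℤ T k) (h : kroneckerPairing ℤ ℤ T k β z ≠ 0) :
    singularCohomology.ringChange (algebraMap ℤ K) T k β ≠ 0 := by
  induction β using singularCohomology_induction_on with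
  | h a =>
    obtain ⟨zc, rfl⟩ :=
      (ModuleCat.epi_iff_surjective ((singularChainComplex ℤ ℤ T).homologyπ k)).1 inferInstance z
    obtain ⟨z', hz'⟩ := exists_cycles_baseChangeChain K zc
    intro h0
    have key := kroneckerPairing_ringChange_eq_cast K a zc z' hz'
    rw [h0, LinearMap.map_zero, LinearMap.zero_apply] at key
    exact h ((algebraMap ℤ K).injective_int (by rw [map_zero]; exact key.symm))

end Literature.AlgebraicTopology.SingularHomology

end
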